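import Summits.Ventures.PercRepro2.CaseOneStarAgg
import Summits.Ventures.PercRepro2.CaseOneHB1Avoid

/-!
# The marked star: the facts of the base extended by `hB1` (blind cell PercRepro2, p1 g36)

`SFactsB m`: the twelve atoms of `SFacts m` (CaseOneStarFacts.lean) and the thirteenth,
`hB1 : 0 ≤ c₉ · c₄ − c₁ · c₁₀` — the cell fact of P1-G35 §6 that certifies every base-cone-infeasible
Bernstein coefficient of the sister gadgets `uwb` / `uwa1b` (kit j328796, 290 / 290 at degree 3).
**`sFactsB`**: it holds at the cell masses of every product law — `sFacts` (CaseOneStarAgg.lean)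
together with the theorem `CaseOne.HB1_holds` (CaseOneHB1Avoid.lean). The sister gadgets' chains
are therefore plain `SFactsB`-cone chains, unconditionally. Standard axioms. -/

namespace Summit.Ventures.PercRepro2

namespace CaseOne

section FactsB
variable {R : Type*} [CommRing R] [LinearOrder R] [IsStrictOrderedRing R]

/-- The facts of the base in the cell vocabulary, extended by the cell fact `hB1`. -/
structure SFactsB (m : SCells R) : Prop extends SFacts m where
  /-- `hB1`: `c₁ · c₁₀ ≤ c₉ · c₄` (`CaseOne.HB1_holds`) -/
  hB1 : 0 ≤ m.c9 * m.c4 - m.c1 * m.c10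

end FactsB

section FactsBProof
variable {V : Type*} {E : Type*} [Fintype E] [DecidableEq E] [Fintype V] [DecidableEq V]
  {R : Type*} [Field R] [LinearOrder R] [IsStrictOrderedRing R]
variable {ends : E → Sym2 V} {o a₁ a₂ b : V}

/-- **The extended facts hold at every product law**: `sFacts` and `HB1_holds`. -/
theorem sFactsB (p : E → R) (hp : IsProbVec p) : SFactsB (scells p ends o a₁ a₂ b) := by
  refine ⟨sFacts p hp, ?_⟩
  have h := HB1_holds p hp ends o a₁ a₂ b
  unfold HB1 at h
  simp only [scells]
  linarith

end FactsBProof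

end CaseOne

end Summit.Ventures.PercRepro2
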